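import Literature.Analysis.FunctionSpaces.TorusLowOrderLeibniz
import HarnessLib

/-!
# Pointwise derivative sizes and third-order derivative bounds for products and composites on the torus

Analysis/FunctionSpaces support file (everything proved; no named facts). Bookkeeping for the
elementary (orders `≤ 3`) case of the Moser-type calculus inequalities used by the energy method
for quasilinear symmetric hyperbolic systems (Majda 1984, Ch. 2 §2.1, Prop. 2.1 (2.1)–(2.3)):
coefficients `A(U)` of such a system are products and composites of the unknowns, and the `H³`
estimate needs pointwise bounds of their derivatives of orders `≤ 3` that are CONSTANT at orders
`0, 1` and LINEAR in the second- and third-derivative "sizes" of the unknowns at orders `2, 3`,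
with constants depending only on a priori `C¹` bounds. This file provides

* the sizes `Torus.dsize₁/₂/₃ φ x = ∑ |∂φ(x)|` over all coordinate derivatives of order 1/2/3;
* pointwise Leibniz bounds of orders 1–3 for products (`abs_partialDeriv_mul_le₁/₂/₃`) and the
  size form of the composite bounds of `TorusLowOrderLeibniz` (`abs_partialDeriv_comp_le_of_size`);
* the predicate `Torus.HasDerivBoundsAt₃ φ x C S₂ S₃` (`|φ|, |∂φ| ≤ C`, `|∂²φ| ≤ C(1 + S₂)`,
  `|∂³φ| ≤ C(1 + S₂ + S₃)` at `x`) and its closure under constant multiples, products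
  (`HasDerivBoundsAt₃.mul`, constant `8CC'`), composites with functions smooth near the range
  (`hasDerivBoundsAt₃_comp`, constant `K(1 + M₁)³`), enlarging `C, S₂, S₃`, and the tautological
  instance for the unknown itself (`hasDerivBoundsAt₃_self`).

## References

* A. Majda, *Compressible Fluid Flow and Systems of Conservation Laws in Several Space
  Variables*, Springer 1984, Ch. 2 §2.1, Prop. 2.1. [`Majda1984`]
-/

noncomputable section

open Set Function
open scoped ContDiff

namespace Literature.Analysis.FunctionSpaces

namespace Torus

variable {d : Type*} [Fintype d] [DecidableEq d]

/-! ## Derivative sizes -/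

/-- First-derivative size `∑ᵢ |∂ᵢφ(x)|` of a scalar torus function at a point. [folklore] -/
def dsize₁ (φ : UnitAddTorus d → ℝ) (x : UnitAddTorus d) : ℝ := ∑ i, |partialDeriv i φ x|

/-- Second-derivative size `∑ᵢⱼ |∂ⱼ∂ᵢφ(x)|`. [folklore] -/
def dsize₂ (φ : UnitAddTorus d → ℝ) (x : UnitAddTorus d) : ℝ :=
  ∑ i, ∑ j, |partialDeriv j (partialDeriv i φ) x|

/-- Third-derivative size `∑ᵢⱼₖ |∂ₖ∂ⱼ∂ᵢφ(x)|`. [folklore] -/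
def dsize₃ (φ : UnitAddTorus d → ℝ) (x : UnitAddTorus d) : ℝ :=
  ∑ i, ∑ j, ∑ k, |partialDeriv k (partialDeriv j (partialDeriv i φ)) x|

/-- Sizes are nonnegative. [folklore] -/
theorem dsize₁_nonneg (φ : UnitAddTorus d → ℝ) (x : UnitAddTorus d) : 0 ≤ dsize₁ φ x :=
  Finset.sum_nonneg fun _ _ => abs_nonneg _

/-- Sizes are nonnegative. [folklore] -/
theorem dsize₂_nonneg (φ : UnitAddTorus d → ℝ) (x : UnitAddTorus d) : 0 ≤ dsize₂ φ x :=
  Finset.sum_nonneg fun _ _ => Finset.sum_nonneg fun _ _ => abs_nonneg _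

/-- Sizes are nonnegative. [folklore] -/
theorem dsize₃_nonneg (φ : UnitAddTorus d → ℝ) (x : UnitAddTorus d) : 0 ≤ dsize₃ φ x :=
  Finset.sum_nonneg fun _ _ => Finset.sum_nonneg fun _ _ => Finset.sum_nonneg fun _ _ => abs_nonneg _

/-- A single first derivative is bounded by the size. [folklore] -/
theorem abs_partialDeriv_le_dsize₁ (φ : UnitAddTorus d → ℝ) (x : UnitAddTorus d) (i : d) :
    |partialDeriv i φ x| ≤ dsize₁ φ x :=
  Finset.single_le_sum (f := fun i => |partialDeriv i φ x|) (fun _ _ => abs_nonneg _) (Finset.mem_univ i)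

/-- A single second derivative is bounded by the size. [folklore] -/
theorem abs_partialDeriv₂_le_dsize₂ (φ : UnitAddTorus d → ℝ) (x : UnitAddTorus d) (i j : d) :
    |partialDeriv j (partialDeriv i φ) x| ≤ dsize₂ φ x := by
  refine le_trans ?_ (Finset.single_le_sum (f := fun i => ∑ j, |partialDeriv j (partialDeriv i φ) x|)
    (fun _ _ => Finset.sum_nonneg fun _ _ => abs_nonneg _) (Finset.mem_univ i))
  exact Finset.single_le_sum (f := fun j => |partialDeriv j (partialDeriv i φ) x|) (fun _ _ => abs_nonneg _)
    (Finset.mem_univ j)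

/-- A single third derivative is bounded by the size. [folklore] -/
theorem abs_partialDeriv₃_le_dsize₃ (φ : UnitAddTorus d → ℝ) (x : UnitAddTorus d) (i j k : d) :
    |partialDeriv k (partialDeriv j (partialDeriv i φ)) x| ≤ dsize₃ φ x := by
  refine le_trans ?_ (Finset.single_le_sum
    (f := fun i => ∑ j, ∑ k, |partialDeriv k (partialDeriv j (partialDeriv i φ)) x|)
    (fun _ _ => Finset.sum_nonneg fun _ _ => Finset.sum_nonneg fun _ _ => abs_nonneg _) (Finset.mem_univ i))
  refine le_trans ?_ (Finset.single_le_sum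
    (f := fun j => ∑ k, |partialDeriv k (partialDeriv j (partialDeriv i φ)) x|)
    (fun _ _ => Finset.sum_nonneg fun _ _ => abs_nonneg _) (Finset.mem_univ j))
  exact Finset.single_le_sum (f := fun k => |partialDeriv k (partialDeriv j (partialDeriv i φ)) x|)
    (fun _ _ => abs_nonneg _) (Finset.mem_univ k)

/-! ## Pointwise Leibniz bounds for products of scalars -/

section Products

variable {f g : UnitAddTorus d → ℝ} {x : UnitAddTorus d} {f₀ f₁ f₂ f₃ g₀ g₁ g₂ g₃ : ℝ}

/-- Order one: `|∂ᵢ(fg)(x)| ≤ f₀ g₁ + f₁ g₀`. [folklore] -/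
theorem abs_partialDeriv_mul_le₁ (hf : IsSmooth f) (hg : IsSmooth g) (hf₀ : |f x| ≤ f₀)
    (hf₁ : ∀ i, |partialDeriv i f x| ≤ f₁) (hg₀ : |g x| ≤ g₀) (hg₁ : ∀ i, |partialDeriv i g x| ≤ g₁)
    (i : d) : |partialDeriv i (fun y => f y * g y) x| ≤ f₀ * g₁ + f₁ * g₀ := by
  have h := partialDeriv_mul_sub hf hg i x
  have e : partialDeriv i (fun y => f y * g y) x = f x * partialDeriv i g x + partialDeriv i f x * g x := by
    linarith
  rw [e]
  refine (abs_add_le _ _).trans (add_le_add ?_ ?_)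
  · rw [abs_mul]; exact mul_le_mul (hf₀) (hg₁ i) (abs_nonneg _) ((abs_nonneg _).trans hf₀)
  · rw [abs_mul]; exact mul_le_mul (hf₁ i) hg₀ (abs_nonneg _) ((abs_nonneg _).trans (hf₁ i))

/-- Order two: `|∂ⱼ∂ᵢ(fg)(x)| ≤ f₀ g₂ + 2 f₁ g₁ + f₂ g₀`. [folklore] -/
theorem abs_partialDeriv_mul_le₂ (hf : IsSmooth f) (hg : IsSmooth g) (hf₀ : |f x| ≤ f₀)
    (hf₁ : ∀ i, |partialDeriv i f x| ≤ f₁) (hf₂ : ∀ i j, |partialDeriv j (partialDeriv i f) x| ≤ f₂)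
    (hg₀ : |g x| ≤ g₀) (hg₁ : ∀ i, |partialDeriv i g x| ≤ g₁)
    (hg₂ : ∀ i j, |partialDeriv j (partialDeriv i g) x| ≤ g₂) (i j : d) :
    |partialDeriv j (partialDeriv i (fun y => f y * g y)) x| ≤ f₀ * g₂ + 2 * (f₁ * g₁) + f₂ * g₀ := by
  have h := partialDeriv₂_mul_sub hf hg i j x
  have e : partialDeriv j (partialDeriv i (fun y => f y * g y)) x =
      f x * partialDeriv j (partialDeriv i g) x + (partialDeriv j (partialDeriv i f) x * g x +
        partialDeriv i f x * partialDeriv j g x + partialDeriv j f x * partialDeriv i g x) := by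
    linarith
  have n0 : 0 ≤ f₀ := (abs_nonneg _).trans hf₀
  have n1 : 0 ≤ f₁ := (abs_nonneg _).trans (hf₁ i)
  have n2 : 0 ≤ f₂ := (abs_nonneg _).trans (hf₂ i j)
  rw [e]
  refine (abs_add_le _ _).trans ?_
  have h1 : |f x * partialDeriv j (partialDeriv i g) x| ≤ f₀ * g₂ := by
    rw [abs_mul]; exact mul_le_mul hf₀ (hg₂ i j) (abs_nonneg _) n0
  have h2 : |partialDeriv j (partialDeriv i f) x * g x| ≤ f₂ * g₀ := by
    rw [abs_mul]; exact mul_le_mul (hf₂ i j) hg₀ (abs_nonneg _) n2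
  have h3 : |partialDeriv i f x * partialDeriv j g x| ≤ f₁ * g₁ := by
    rw [abs_mul]; exact mul_le_mul (hf₁ i) (hg₁ j) (abs_nonneg _) n1
  have h4 : |partialDeriv j f x * partialDeriv i g x| ≤ f₁ * g₁ := by
    rw [abs_mul]; exact mul_le_mul (hf₁ j) (hg₁ i) (abs_nonneg _) n1
  have h5 := abs_add_three (partialDeriv j (partialDeriv i f) x * g x)
    (partialDeriv i f x * partialDeriv j g x) (partialDeriv j f x * partialDeriv i g x)
  linarith

/-- Order three: `|∂ₖ∂ⱼ∂ᵢ(fg)(x)| ≤ f₀ g₃ + 3 f₁ g₂ + 3 f₂ g₁ + f₃ g₀`. [folklore] -/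
theorem abs_partialDeriv_mul_le₃ (hf : IsSmooth f) (hg : IsSmooth g) (hf₀ : |f x| ≤ f₀)
    (hf₁ : ∀ i, |partialDeriv i f x| ≤ f₁) (hf₂ : ∀ i j, |partialDeriv j (partialDeriv i f) x| ≤ f₂)
    (hf₃ : ∀ i j k, |partialDeriv k (partialDeriv j (partialDeriv i f)) x| ≤ f₃)
    (hg₀ : |g x| ≤ g₀) (hg₁ : ∀ i, |partialDeriv i g x| ≤ g₁)
    (hg₂ : ∀ i j, |partialDeriv j (partialDeriv i g) x| ≤ g₂)
    (hg₃ : ∀ i j k, |partialDeriv k (partialDeriv j (partialDeriv i g)) x| ≤ g₃) (i j k : d) :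
    |partialDeriv k (partialDeriv j (partialDeriv i (fun y => f y * g y))) x| ≤
      f₀ * g₃ + 3 * (f₁ * g₂) + 3 * (f₂ * g₁) + f₃ * g₀ := by
  have h := partialDeriv₃_mul_sub hf hg i j k x
  have n0 : 0 ≤ f₀ := (abs_nonneg _).trans hf₀
  have n1 : 0 ≤ f₁ := (abs_nonneg _).trans (hf₁ i)
  have n2 : 0 ≤ f₂ := (abs_nonneg _).trans (hf₂ i j)
  have n3 : 0 ≤ f₃ := (abs_nonneg _).trans (hf₃ i j k)
  set A := f x * partialDeriv k (partialDeriv j (partialDeriv i g)) x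
  set B₁ := partialDeriv k (partialDeriv j (partialDeriv i f)) x * g x
  set B₂ := partialDeriv j (partialDeriv i f) x * partialDeriv k g x
  set B₃ := partialDeriv k (partialDeriv i f) x * partialDeriv j g x
  set B₄ := partialDeriv i f x * partialDeriv k (partialDeriv j g) x
  set B₅ := partialDeriv k (partialDeriv j f) x * partialDeriv i g x
  set B₆ := partialDeriv j f x * partialDeriv k (partialDeriv i g) x
  set B₇ := partialDeriv k f x * partialDeriv j (partialDeriv i g) x
  have e : partialDeriv k (partialDeriv j (partialDeriv i (fun y => f y * g y))) x =
      A + (B₁ + B₂ + B₃ + B₄ + B₅ + B₆ + B₇) := by linarith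
  have hA : |A| ≤ f₀ * g₃ := by
    simp only [A]; rw [abs_mul]; exact mul_le_mul hf₀ (hg₃ i j k) (abs_nonneg _) n0
  have h1 : |B₁| ≤ f₃ * g₀ := by
    simp only [B₁]; rw [abs_mul]; exact mul_le_mul (hf₃ i j k) hg₀ (abs_nonneg _) n3
  have h2 : |B₂| ≤ f₂ * g₁ := by
    simp only [B₂]; rw [abs_mul]; exact mul_le_mul (hf₂ i j) (hg₁ k) (abs_nonneg _) n2
  have h3 : |B₃| ≤ f₂ * g₁ := by
    simp only [B₃]; rw [abs_mul]; exact mul_le_mul (hf₂ i k) (hg₁ j) (abs_nonneg _) n2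
  have h4 : |B₄| ≤ f₁ * g₂ := by
    simp only [B₄]; rw [abs_mul]; exact mul_le_mul (hf₁ i) (hg₂ j k) (abs_nonneg _) n1
  have h5 : |B₅| ≤ f₂ * g₁ := by
    simp only [B₅]; rw [abs_mul]; exact mul_le_mul (hf₂ j k) (hg₁ i) (abs_nonneg _) n2
  have h6 : |B₆| ≤ f₁ * g₂ := by
    simp only [B₆]; rw [abs_mul]; exact mul_le_mul (hf₁ j) (hg₂ i k) (abs_nonneg _) n1
  have h7 : |B₇| ≤ f₁ * g₂ := by
    simp only [B₇]; rw [abs_mul]; exact mul_le_mul (hf₁ k) (hg₂ i j) (abs_nonneg _) n1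
  rw [e]
  have t1 := abs_add_le A (B₁ + B₂ + B₃ + B₄ + B₅ + B₆ + B₇)
  have t2 := abs_add_le (B₁ + B₂ + B₃ + B₄ + B₅ + B₆) B₇
  have t3 := abs_add_le (B₁ + B₂ + B₃ + B₄ + B₅) B₆
  have t4 := abs_add_le (B₁ + B₂ + B₃ + B₄) B₅
  have t5 := abs_add_le (B₁ + B₂ + B₃) B₄
  have t6 := abs_add_three B₁ B₂ B₃
  linarith

end Products

/-! ## Pointwise bounds for composites in terms of sizes -/

section Composite

variable {φ : ℝ → ℝ} {V : Set ℝ} {w : UnitAddTorus d → ℝ} {x : UnitAddTorus d} {C₁ C₂ C₃ w₁ : ℝ}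

/-- Composite bounds of orders 1–3 from `|∂ᵢw(x)| ≤ w₁` and the sizes `dsize₂ w x`, `dsize₃ w x`:
`|∂(φ∘w)| ≤ C₁w₁`, `|∂²(φ∘w)| ≤ C₂w₁² + C₁ S₂`, `|∂³(φ∘w)| ≤ C₃w₁³ + 3C₂w₁S₂ + C₁S₃`. [folklore] -/
theorem abs_partialDeriv_comp_le_of_size (hφ : ContDiffOn ℝ ∞ φ V) (hV : IsOpen V) (hw : IsSmooth w)
    (hwV : ∀ y, w y ∈ V) (hC₁ : ∀ y, |deriv φ (w y)| ≤ C₁) (hC₂ : ∀ y, |deriv (deriv φ) (w y)| ≤ C₂)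
    (hC₃ : ∀ y, |deriv (deriv (deriv φ)) (w y)| ≤ C₃) (hw₁ : ∀ i, |partialDeriv i w x| ≤ w₁) :
    (∀ i, |partialDeriv i (fun z => φ (w z)) x| ≤ C₁ * w₁) ∧
    (∀ i j, |partialDeriv j (partialDeriv i (fun z => φ (w z))) x| ≤ C₂ * w₁ ^ 2 + C₁ * dsize₂ w x) ∧
    (∀ i j k, |partialDeriv k (partialDeriv j (partialDeriv i (fun z => φ (w z)))) x| ≤
      C₃ * w₁ ^ 3 + 3 * (C₂ * (w₁ * dsize₂ w x)) + C₁ * dsize₃ w x) := by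
  have n1 : 0 ≤ C₁ := (abs_nonneg _).trans (hC₁ x)
  have n2 : 0 ≤ C₂ := (abs_nonneg _).trans (hC₂ x)
  have n3 : 0 ≤ C₃ := (abs_nonneg _).trans (hC₃ x)
  have hS₂ : ∀ i j, |partialDeriv j (partialDeriv i w) x| ≤ dsize₂ w x := abs_partialDeriv₂_le_dsize₂ w x
  have hS₂0 : 0 ≤ dsize₂ w x := dsize₂_nonneg w x
  refine ⟨fun i => ?_, fun i j => ?_, fun i j k => ?_⟩
  · exact (abs_partialDeriv_comp_le hφ hV hw hwV hC₁ i x).trans (mul_le_mul_of_nonneg_left (hw₁ i) n1)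
  · have h := abs_partialDeriv₂_comp_le hφ hV hw hwV hC₁ hC₂ i j x
    have nw : 0 ≤ w₁ := (abs_nonneg _).trans (hw₁ i)
    have p1 : |partialDeriv j w x| * |partialDeriv i w x| ≤ w₁ ^ 2 := by
      rw [sq]; exact mul_le_mul (hw₁ j) (hw₁ i) (abs_nonneg _) nw
    exact h.trans (add_le_add (mul_le_mul_of_nonneg_left p1 n2) (mul_le_mul_of_nonneg_left (hS₂ i j) n1))
  · have h := abs_partialDeriv₃_comp_le hφ hV hw hwV hC₁ hC₂ hC₃ i j k x
    have nw : 0 ≤ w₁ := (abs_nonneg _).trans (hw₁ i)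
    have p1 : |partialDeriv k w x| * |partialDeriv j w x| * |partialDeriv i w x| ≤ w₁ ^ 3 := by
      have h2 : |partialDeriv k w x| * |partialDeriv j w x| ≤ w₁ * w₁ :=
        mul_le_mul (hw₁ k) (hw₁ j) (abs_nonneg _) nw
      calc |partialDeriv k w x| * |partialDeriv j w x| * |partialDeriv i w x| ≤ w₁ * w₁ * w₁ :=
            mul_le_mul h2 (hw₁ i) (abs_nonneg _) (mul_nonneg nw nw)
        _ = w₁ ^ 3 := by ring
    have q : ∀ (p q : ℝ) {i' : d} {i'' j'' : d}, p = |partialDeriv i' w x| →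
        q = |partialDeriv j'' (partialDeriv i'' w) x| → q * p ≤ w₁ * dsize₂ w x ∧ p * q ≤ w₁ * dsize₂ w x := by
      intro p q i' i'' j'' hp hq
      subst hp; subst hq
      have h1 : |partialDeriv j'' (partialDeriv i'' w) x| * |partialDeriv i' w x| ≤ dsize₂ w x * w₁ :=
        mul_le_mul (hS₂ i'' j'') (hw₁ i') (abs_nonneg _) hS₂0
      constructor
      · linarith [mul_comm (dsize₂ w x) w₁]
      · linarith [mul_comm (dsize₂ w x) w₁, mul_comm (|partialDeriv i' w x|) (|partialDeriv j'' (partialDeriv i'' w) x|)]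
    have p2 : |partialDeriv k (partialDeriv j w) x| * |partialDeriv i w x| +
        |partialDeriv j w x| * |partialDeriv k (partialDeriv i w) x| +
        |partialDeriv k w x| * |partialDeriv j (partialDeriv i w) x| ≤ 3 * (w₁ * dsize₂ w x) := by
      have a1 := (q _ _ (i' := i) (i'' := j) (j'' := k) rfl rfl).1
      have a2 := (q _ _ (i' := j) (i'' := i) (j'' := k) rfl rfl).2
      have a3 := (q _ _ (i' := k) (i'' := i) (j'' := j) rfl rfl).2
      linarith
    have p3 := abs_partialDeriv₃_le_dsize₃ w x i j k
    refine h.trans (add_le_add (add_le_add (mul_le_mul_of_nonneg_left p1 n3) ?_)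
      (mul_le_mul_of_nonneg_left p3 n1))
    calc C₂ * _ ≤ C₂ * (3 * (w₁ * dsize₂ w x)) := mul_le_mul_of_nonneg_left p2 n2
      _ = 3 * (C₂ * (w₁ * dsize₂ w x)) := by ring

end Composite

/-! ## Constant multiples -/

/-- `∂ᵢ(c f) = c ∂ᵢf` as functions, for a `C¹` scalar `f`. [folklore] -/
theorem partialDeriv_const_mul_fun {f : UnitAddTorus d → ℝ} (hf : IsContDiff 1 f) (c : ℝ) (i : d) :
    partialDeriv i (fun y => c * f y) = fun y => c * partialDeriv i f y := by
  have h := partialDeriv_const_smul hf c i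
  have e1 : (fun y => c * f y) = c • f := rfl
  rw [e1, h]
  rfl

/-- Derivatives of orders 1–3 of a constant multiple of a smooth scalar. [folklore] -/
theorem partialDeriv₃_const_mul {f : UnitAddTorus d → ℝ} (hf : IsSmooth f) (c : ℝ) (i j k : d)
    (x : UnitAddTorus d) :
    partialDeriv i (fun y => c * f y) x = c * partialDeriv i f x ∧
    partialDeriv j (partialDeriv i (fun y => c * f y)) x = c * partialDeriv j (partialDeriv i f) x ∧
    partialDeriv k (partialDeriv j (partialDeriv i (fun y => c * f y))) x =
      c * partialDeriv k (partialDeriv j (partialDeriv i f)) x := by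
  have h1 := partialDeriv_const_mul_fun (hf.isContDiff (by simp)) c i
  have h2 := partialDeriv_const_mul_fun ((hf.partialDeriv i).isContDiff (by simp)) c j
  have h3 := partialDeriv_const_mul_fun (((hf.partialDeriv i).partialDeriv j).isContDiff (by simp)) c k
  exact ⟨by rw [h1], by rw [h1, h2], by rw [h1, h2, h3]⟩

/-! ## Bounds of orders `≤ 3` at a point, linear in the sizes -/

/-- `φ` and its derivatives of orders `1, 2, 3` at `x` are bounded by `C`, `C`, `C(1 + S₂)`,
`C(1 + S₂ + S₃)`. [folklore] -/
structure HasDerivBoundsAt₃ (φ : UnitAddTorus d → ℝ) (x : UnitAddTorus d) (C S₂ S₃ : ℝ) : Prop where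
  zero : |φ x| ≤ C
  one : ∀ i, |partialDeriv i φ x| ≤ C
  two : ∀ i j, |partialDeriv j (partialDeriv i φ) x| ≤ C * (1 + S₂)
  three : ∀ i j k, |partialDeriv k (partialDeriv j (partialDeriv i φ)) x| ≤ C * (1 + S₂ + S₃)

namespace HasDerivBoundsAt₃

variable {φ ψ : UnitAddTorus d → ℝ} {x : UnitAddTorus d} {C C' S₂ S₃ : ℝ}

omit [Fintype d] in
/-- The constant is nonnegative. [folklore] -/
theorem nonneg (h : HasDerivBoundsAt₃ φ x C S₂ S₃) : 0 ≤ C := (abs_nonneg _).trans h.zero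

omit [Fintype d] in
/-- Monotonicity in the constant (for `S₂, S₃ ≥ 0`). [folklore] -/
theorem mono (h : HasDerivBoundsAt₃ φ x C S₂ S₃) (hC : C ≤ C') (hS₂ : 0 ≤ S₂) (hS₃ : 0 ≤ S₃) :
    HasDerivBoundsAt₃ φ x C' S₂ S₃ where
  zero := h.zero.trans hC
  one i := (h.one i).trans hC
  two i j := (h.two i j).trans (mul_le_mul_of_nonneg_right hC (by positivity))
  three i j k := (h.three i j k).trans (mul_le_mul_of_nonneg_right hC (by positivity))

/-- Constant multiples. [folklore] -/
theorem const_mul (h : HasDerivBoundsAt₃ φ x C S₂ S₃) (hφ : IsSmooth φ) (c : ℝ) :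
    HasDerivBoundsAt₃ (fun y => c * φ y) x (|c| * C) S₂ S₃ where
  zero := by rw [abs_mul]; exact mul_le_mul_of_nonneg_left h.zero (abs_nonneg _)
  one i := by
    rw [(partialDeriv₃_const_mul hφ c i i i x).1, abs_mul]
    exact mul_le_mul_of_nonneg_left (h.one i) (abs_nonneg _)
  two i j := by
    rw [(partialDeriv₃_const_mul hφ c i j j x).2.1, abs_mul, mul_assoc]
    exact mul_le_mul_of_nonneg_left (h.two i j) (abs_nonneg _)
  three i j k := by
    rw [(partialDeriv₃_const_mul hφ c i j k x).2.2, abs_mul, mul_assoc]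
    exact mul_le_mul_of_nonneg_left (h.three i j k) (abs_nonneg _)

/-- **Products**: `HasDerivBoundsAt₃` is closed under products, with constant `8 C C'`
(for `S₂, S₃ ≥ 0`). [folklore] -/
theorem mul (hφ : HasDerivBoundsAt₃ φ x C S₂ S₃) (hψ : HasDerivBoundsAt₃ ψ x C' S₂ S₃) (hsφ : IsSmooth φ)
    (hsψ : IsSmooth ψ) (hS₂ : 0 ≤ S₂) (hS₃ : 0 ≤ S₃) :
    HasDerivBoundsAt₃ (fun y => φ y * ψ y) x (8 * C * C') S₂ S₃ := by
  have n := hφ.nonneg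
  have n' := hψ.nonneg
  have hCC : 0 ≤ C * C' := mul_nonneg n n'
  have hCS : 0 ≤ C * C' * S₂ := mul_nonneg hCC hS₂
  have hCS' : 0 ≤ C * C' * S₃ := mul_nonneg hCC hS₃
  refine ⟨?_, fun i => ?_, fun i j => ?_, fun i j k => ?_⟩
  · rw [abs_mul]
    have := mul_le_mul hφ.zero hψ.zero (abs_nonneg _) n
    nlinarith
  · have := abs_partialDeriv_mul_le₁ hsφ hsψ hφ.zero hφ.one hψ.zero hψ.one i
    nlinarith
  · have := abs_partialDeriv_mul_le₂ hsφ hsψ hφ.zero hφ.one hφ.two hψ.zero hψ.one hψ.two i j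
    have e : C * (C' * (1 + S₂)) + 2 * (C * C') + C * (1 + S₂) * C' = C * C' * (4 + 2 * S₂) := by ring
    rw [e] at this
    refine this.trans ?_
    nlinarith
  · have := abs_partialDeriv_mul_le₃ hsφ hsψ hφ.zero hφ.one hφ.two hφ.three hψ.zero hψ.one hψ.two
      hψ.three i j k
    have e : C * (C' * (1 + S₂ + S₃)) + 3 * (C * (C' * (1 + S₂))) + 3 * (C * (1 + S₂) * C') +
        C * (1 + S₂ + S₃) * C' = C * C' * (8 + 8 * S₂ + 2 * S₃) := by ring
    rw [e] at this
    refine this.trans ?_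
    nlinarith

end HasDerivBoundsAt₃

/-- **Composites** `φ ∘ w`: if `φ` and its first three derivatives are bounded by `K` on the range
of `w` and `|∂ᵢw| ≤ M₁` (`M₁ ≥ 0`), then
`HasDerivBoundsAt₃ (φ ∘ w) x (K (1 + M₁)³) (dsize₂ w x) (dsize₃ w x)`. [folklore] -/
theorem hasDerivBoundsAt₃_comp {φ : ℝ → ℝ} {V : Set ℝ} {w : UnitAddTorus d → ℝ} (hφ : ContDiffOn ℝ ∞ φ V)
    (hV : IsOpen V) (hw : IsSmooth w) (hwV : ∀ y, w y ∈ V) {K M₁ : ℝ} (hK₀ : ∀ y, |φ (w y)| ≤ K)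
    (hK₁ : ∀ y, |deriv φ (w y)| ≤ K) (hK₂ : ∀ y, |deriv (deriv φ) (w y)| ≤ K)
    (hK₃ : ∀ y, |deriv (deriv (deriv φ)) (w y)| ≤ K) (hM0 : 0 ≤ M₁)
    (hM₁ : ∀ y i, |partialDeriv i w y| ≤ M₁) (x : UnitAddTorus d) :
    HasDerivBoundsAt₃ (fun z => φ (w z)) x (K * (1 + M₁) ^ 3) (dsize₂ w x) (dsize₃ w x) := by
  obtain ⟨h1, h2, h3⟩ := abs_partialDeriv_comp_le_of_size hφ hV hw hwV hK₁ hK₂ hK₃ (hM₁ x) (x := x)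
  have nK : 0 ≤ K := (abs_nonneg _).trans (hK₀ x)
  have hS₂ := dsize₂_nonneg w x
  have hS₃ := dsize₃_nonneg w x
  have hp : 1 ≤ (1 + M₁) ^ 3 := one_le_pow₀ (by linarith)
  refine ⟨?_, fun i => ?_, fun i j => ?_, fun i j k => ?_⟩
  · exact (hK₀ x).trans (le_mul_of_one_le_right nK hp)
  · refine (h1 i).trans ?_
    have h' : 1 + M₁ ≤ (1 + M₁) ^ 3 := le_self_pow₀ (by linarith) (by norm_num)
    have : M₁ ≤ (1 + M₁) ^ 3 := by linarith
    exact mul_le_mul_of_nonneg_left this nK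
  · refine (h2 i j).trans ?_
    nlinarith [mul_nonneg nK hS₂, mul_nonneg (mul_nonneg nK hM0) hS₂, mul_nonneg nK hM0,
      mul_nonneg (mul_nonneg nK hM0) hM0]
  · refine (h3 i j k).trans ?_
    nlinarith [mul_nonneg nK hS₂, mul_nonneg nK hS₃, mul_nonneg (mul_nonneg nK hM0) hS₂,
      mul_nonneg (mul_nonneg nK hM0) hS₃, mul_nonneg (mul_nonneg (mul_nonneg nK hM0) hM0) hS₂,
      mul_nonneg (mul_nonneg (mul_nonneg nK hM0) hM0) hS₃, mul_nonneg nK hM0,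
      mul_nonneg (mul_nonneg nK hM0) hM0]

namespace HasDerivBoundsAt₃

variable {φ : UnitAddTorus d → ℝ} {x : UnitAddTorus d} {C S₂ S₃ S₂' S₃' : ℝ}

omit [Fintype d] in
/-- Enlarging the sizes. [folklore] -/
theorem mono_size (h : HasDerivBoundsAt₃ φ x C S₂ S₃) (h₂ : S₂ ≤ S₂') (h₃ : S₃ ≤ S₃') :
    HasDerivBoundsAt₃ φ x C S₂' S₃' where
  zero := h.zero
  one := h.one
  two i j := (h.two i j).trans (mul_le_mul_of_nonneg_left (by linarith) h.nonneg)
  three i j k := (h.three i j k).trans (mul_le_mul_of_nonneg_left (by linarith) h.nonneg)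

end HasDerivBoundsAt₃

/-- **The unknown itself**: if `|w(x)| ≤ A` and `|∂ᵢw| ≤ M₁`, then
`HasDerivBoundsAt₃ w x (max (max A M₁) 1) (dsize₂ w x) (dsize₃ w x)`. [folklore] -/
theorem hasDerivBoundsAt₃_self {w : UnitAddTorus d → ℝ} {x : UnitAddTorus d} {A M₁ : ℝ} (hA : |w x| ≤ A)
    (hM₁ : ∀ i, |partialDeriv i w x| ≤ M₁) :
    HasDerivBoundsAt₃ w x (max (max A M₁) 1) (dsize₂ w x) (dsize₃ w x) where
  zero := hA.trans ((le_max_left _ _).trans (le_max_left _ _))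
  one i := (hM₁ i).trans ((le_max_right _ _).trans (le_max_left _ _))
  two i j := by
    have h := abs_partialDeriv₂_le_dsize₂ w x i j
    have h1 : (1 : ℝ) ≤ max (max A M₁) 1 := le_max_right _ _
    have h2 := dsize₂_nonneg w x
    nlinarith
  three i j k := by
    have h := abs_partialDeriv₃_le_dsize₃ w x i j k
    have h1 : (1 : ℝ) ≤ max (max A M₁) 1 := le_max_right _ _
    have h2 := dsize₂_nonneg w x
    have h3 := dsize₃_nonneg w x
    nlinarith

end Torus

end Literature.Analysis.FunctionSpaces

end
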